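import Mathlib
import HarnessLib
import Summits.HubbardSuperconductivity.HubbardSuperconductivity.Theorems.KLProgrammeKLRegimeEngineV8DefsQ8
import Summits.HubbardSuperconductivity.HubbardSuperconductivity.Theorems.KLProgrammeKLRegimeEngineV8DefsG8
import Summits.HubbardSuperconductivity.HubbardSuperconductivity.Theorems.KLProgrammeKLRegimeEngineV8IsoTupleExport
import Summits.HubbardSuperconductivity.HubbardSuperconductivity.Theorems.KLProgrammeKLRegimeEngineV8PairTransferExport

/-!
# K3 ENGINE package, coupling threshold v10: `klEngU₀10 P R cc` — the v1 door `klEngU₀9` capped by the v2 classes' deferred thresholds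
# (token #14 `klEngU₀9 ↦ klEngU₀10` of the v2 re-registration of the 20437 engine-flow skeleton, plan g17 (R47a)/(R47n); ENTRY LIST OF RECORD
# KL STATUS 2026-08-27 l.3174 (plan g17) + l.3196 (p1 g11, class #5) + l.3200 (k3c2-p2 g8, (c)-E5 lines (b)/(c)))

Cell `gate-hubbard-kl`, seat hubbard-kl-k3c2-p1 g5 (v2 Defs batch).

WHY.  Every v2 internal export class is a STEP Prop with its own deferred coupling threshold `u r cc` (the `∃ + dite` pattern of (R47b): the
constant is whatever the producer needs, never a guessed numeral), read at the raised budget `r := (klEngQ8 P R).CR`; the registered stubs bind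
`U ≤ klEngU₀10 P R c`, so `klEngU₀10` must sit below EVERY such threshold and below the v1 door.  `U₀` is chosen after `G, P, R, Q, c` in
`EngineP4` (`∀ P ∃ Q ∀ R ∀ c ∃ U₀`), so all of this is slot-legal.  THE EIGHT ENTRIES (each with its `_le_` projection):

1. `klEngU₀9 P R cc` — the v1 door (…DefsU9; so every `klEngU₀9`-keyed fact rides: `klEngU₀10_le_klEngU₀9`);
2. `klCUu P R (klEngQ7 P R) (klEngQ8 P R).CR cc` — class #1, the U-currency tower table's step threshold (p5, …TowerExports);
3. `klE5u P R (klEngQ7 P R) (klEngQ8 P R).CR cc` — class #6, the iso fixed-tuple line's threshold (k3c2-p2, …IsoTupleExport);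
4. `klE5ShareU P R (klEngQ8 P R).CR cc` — class #3, the E.5 share's threshold (p5, …E5Share);
5. `klE4UF klEngGeo8 P R (klEngQ8 P R) cc` — class #4, the flow-scale (E4)ₙ package's threshold (k3c3-p2, …DefsG8);
6. `klCTu P R (klEngQ7 P R) (klEngQ8 P R).CR cc` — class #5, the (S)-transfer step's threshold (p1 g11, …PairTransferExport);
7. `klE5RowsU P R := 1 / (4 · max 1 (klE5RowsD klEngGeo8 P (klEngQ8 P R)))` — (c)-E5 line (b): the U-door of k3c2-p2's `rowsSmallness_of_doors`
   (…EngineIsoTupleSmallness), `D` = its displayed coefficient sum, read at the v2 keys `(klEngGeo8, klEngQ8 P R)` (the (c) history at v2 carries the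
   (E2″-F) rows at `Q₈.CR`; `klEngGeo8`'s `abot/atop/CF/cloc/θ` are `klEngGeo7`'s by `rfl`); the `max 1` guard only makes positivity unconditional
   (`D ≥ 1` anyway for well-formed `G`,`P`,`Q`) — consumer `mul_klE5RowsD_le_quarter_of_le_klEngU₀10`;
8. `klE5RateU R := klE0 / (32 · (|R.Gfr 0| + 1))` — (c)-E5 line (c): the frame-rate smallness `R.Gfr 0·U ≤ klE0/32` of the cross-frame row sum
   (`frameDist_klFlowFrameU_succ_le_rate`) — consumer `gfr0_mul_le_of_le_klEngU₀10`.

Plus: `klEngU₀10_pos (h : 0 < R.cz)` / `_pos_of_WF2`, the v1 riders `klEngU₀10_le_klEngU₀8/7/6/4/3`, `_le_klE3U₀`, `_le_cz_mul_klEngU₀4`, the budget hook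
`sq_budget_of_le_klEngU₀10` and `bareFrame_numerals_of_le_klEngU₀10` (one `.trans` each).  THE #14 LIFT LINE of every v1 closer: `hU₉ := hU.trans
(klEngU₀10_le_klEngU₀9 P R cc)`.  Definitions (closed real terms) + signs + one-line algebra; nothing about the model is asserted; nothing asserts
superconductivity.
-/

noncomputable section

namespace Summit.HubbardSuperconductivity.HubbardSuperconductivity.Theorems.EngineV8

set_option linter.dupNamespace false -- summit = problem name (single-conjunct summit), D-0017

open Real Finset Literature.MathematicalPhysics.QuantumLattice Literature.Probability.LatticeModels
open Literature.MathematicalPhysics.QuantumLattice.BandSectorCounting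
open Summit.HubbardSuperconductivity.HubbardSuperconductivity.Theorems.KLRegimeSplit

/-! ## §1 The two (c)-E5 entries -/

/-- **`klE5RowsD G P Q`** — the coefficient sum of the accumulated (E2″-F) rows' `U²`-part, VERBATIM the `D` of k3c2-p2's `rowsSmallness_of_doors`
(…EngineIsoTupleSmallness §1): `(Σ_χ(abot χ + atop χ) + 1) + 24·CR·(Klam² + Klam³) + (16/3)·CF·Klam² + cloc·Klam²·(1 − 4^{−θ})⁻¹ + 2·CR·Klam³ + (4/3)·CR·Klam²`. -/
def klE5RowsD (G : GeoConsts) (P : SplitConsts) (Q : EngConsts) : ℝ :=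
  (∑ χ, (G.abot χ + G.atop χ) + 1) + 24 * Q.CR * (P.Klam ^ 2 + P.Klam ^ 3) + 16 / 3 * G.CF * P.Klam ^ 2 +
    G.cloc * P.Klam ^ 2 * (1 - (4 : ℝ) ^ (-G.θ))⁻¹ + 2 * Q.CR * P.Klam ^ 3 + 4 / 3 * Q.CR * P.Klam ^ 2

/-- Unfolding `klE5RowsD` (the displayed sum, for `rowsSmallness_of_doors`'s `hD`). -/
theorem klE5RowsD_eq (G : GeoConsts) (P : SplitConsts) (Q : EngConsts) :
    klE5RowsD G P Q = (∑ χ, (G.abot χ + G.atop χ) + 1) + 24 * Q.CR * (P.Klam ^ 2 + P.Klam ^ 3) + 16 / 3 * G.CF * P.Klam ^ 2 +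
      G.cloc * P.Klam ^ 2 * (1 - (4 : ℝ) ^ (-G.θ))⁻¹ + 2 * Q.CR * P.Klam ^ 3 + 4 / 3 * Q.CR * P.Klam ^ 2 := rfl

/-- `klE5RowsD G P Q ≤ max 1 (klE5RowsD G P Q)`. -/
theorem klE5RowsD_le_max (G : GeoConsts) (P : SplitConsts) (Q : EngConsts) : klE5RowsD G P Q ≤ max 1 (klE5RowsD G P Q) := le_max_right _ _

/-- **`klE5RowsU P R := 1 / (4 · max 1 (klE5RowsD klEngGeo8 P (klEngQ8 P R)))`** — entry 7: the U-door of the accumulated-rows smallness at the v2 keys. -/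
def klE5RowsU (P : SplitConsts) (R : RenConsts) : ℝ := 1 / (4 * max 1 (klE5RowsD klEngGeo8 P (klEngQ8 P R)))

/-- `0 < klE5RowsU P R` (unconditionally, by the `max 1` guard). -/
theorem klE5RowsU_pos (P : SplitConsts) (R : RenConsts) : 0 < klE5RowsU P R := by
  unfold klE5RowsU
  have : (0 : ℝ) < max 1 (klE5RowsD klEngGeo8 P (klEngQ8 P R)) := lt_of_lt_of_le one_pos (le_max_left _ _)
  positivity

/-- **Entry 7's consumer line**: `0 ≤ U ≤ klE5RowsU P R ⟹ U · klE5RowsD klEngGeo8 P (klEngQ8 P R) ≤ 1/4` (the `hD` of `rowsSmallness_of_doors` at the v2 keys). -/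
theorem mul_klE5RowsD_le_quarter_of_le_klE5RowsU {P : SplitConsts} {R : RenConsts} {U : ℝ} (hU : 0 ≤ U) (h : U ≤ klE5RowsU P R) :
    U * klE5RowsD klEngGeo8 P (klEngQ8 P R) ≤ 1 / 4 := by
  set m : ℝ := max 1 (klE5RowsD klEngGeo8 P (klEngQ8 P R)) with hm
  have hm0 : 0 < m := lt_of_lt_of_le one_pos (le_max_left _ _)
  have hDm : klE5RowsD klEngGeo8 P (klEngQ8 P R) ≤ m := le_max_right _ _
  have h1 : U * klE5RowsD klEngGeo8 P (klEngQ8 P R) ≤ U * m := mul_le_mul_of_nonneg_left hDm hU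
  have h2 : U * m ≤ 1 / (4 * m) * m := mul_le_mul_of_nonneg_right (by simpa [klE5RowsU, hm] using h) hm0.le
  have h3 : 1 / (4 * m) * m = 1 / 4 := by field_simp
  linarith

/-- **`klE5RateU R := klE0 / (32 · (|R.Gfr 0| + 1))`** — entry 8: the frame-rate smallness threshold (`R.Gfr 0 · U ≤ klE0/32` below it). -/
def klE5RateU (R : RenConsts) : ℝ := klE0 / (32 * (|R.Gfr 0| + 1))

/-- `0 < klE5RateU R` (unconditionally). -/
theorem klE5RateU_pos (R : RenConsts) : 0 < klE5RateU R := by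
  unfold klE5RateU klE0; positivity

/-- **Entry 8's consumer line**: `0 ≤ U ≤ klE5RateU R ⟹ R.Gfr 0 · U ≤ klE0/32` (any sign of `R.Gfr 0`). -/
theorem gfr0_mul_le_of_le_klE5RateU {R : RenConsts} {U : ℝ} (hU : 0 ≤ U) (h : U ≤ klE5RateU R) : R.Gfr 0 * U ≤ klE0 / 32 := by
  have hE0 : (0 : ℝ) < klE0 := by norm_num [klE0]
  have ha : 0 ≤ |R.Gfr 0| := abs_nonneg _
  have h1 : R.Gfr 0 * U ≤ |R.Gfr 0| * U := mul_le_mul_of_nonneg_right (le_abs_self _) hU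
  have h2 : |R.Gfr 0| * U ≤ |R.Gfr 0| * (klE0 / (32 * (|R.Gfr 0| + 1))) := mul_le_mul_of_nonneg_left h ha
  have h3 : |R.Gfr 0| * (klE0 / (32 * (|R.Gfr 0| + 1))) ≤ klE0 / 32 := by
    rw [mul_div_assoc', div_le_div_iff₀ (by positivity) (by norm_num)]
    nlinarith
  linarith

/-- The same with `|U|` (`0 ≤ U`). -/
theorem gfr0_mul_abs_le_of_le_klE5RateU {R : RenConsts} {U : ℝ} (hU : 0 ≤ U) (h : U ≤ klE5RateU R) : R.Gfr 0 * |U| ≤ klE0 / 32 := by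
  rw [abs_of_nonneg hU]; exact gfr0_mul_le_of_le_klE5RateU hU h

/-! ## §2 The door `klEngU₀10` -/

/-- **`klEngU₀10 P R cc`** — token #14 of the v2 re-registration: the v1 door `klEngU₀9 P R cc` capped by the deferred thresholds of the v2 classes
#1 (`klCUu`), #6 (`klE5u`), #3 (`klE5ShareU`), #4 (`klE4UF`), #5 (`klCTu`) read at `r := (klEngQ8 P R).CR` / `(klEngGeo8, klEngQ8 P R)`, and by the
two (c)-E5 lines `klE5RowsU`, `klE5RateU`. -/
def klEngU₀10 (P : SplitConsts) (R : RenConsts) (cc : ℝ) : ℝ :=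
  min (klEngU₀9 P R cc)
    (min (klCUu P R (klEngQ7 P R) (klEngQ8 P R).CR cc)
      (min (klE5u P R (klEngQ7 P R) (klEngQ8 P R).CR cc)
        (min (klE5ShareU P R (klEngQ8 P R).CR cc)
          (min (klE4UF klEngGeo8 P R (klEngQ8 P R) cc)
            (min (klCTu P R (klEngQ7 P R) (klEngQ8 P R).CR cc) (min (klE5RowsU P R) (klE5RateU R)))))))

section Projections

variable (P : SplitConsts) (R : RenConsts) (cc : ℝ)

/-- **THE #14 LIFT LINE**: `klEngU₀10 P R cc ≤ klEngU₀9 P R cc` (`hU₉ := hU.trans (klEngU₀10_le_klEngU₀9 P R cc)`). -/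
theorem klEngU₀10_le_klEngU₀9 : klEngU₀10 P R cc ≤ klEngU₀9 P R cc := min_le_left _ _

/-- Entry 2: `klEngU₀10 ≤ klCUu P R (klEngQ7 P R) (klEngQ8 P R).CR cc` (class #1). -/
theorem klEngU₀10_le_klCUu : klEngU₀10 P R cc ≤ klCUu P R (klEngQ7 P R) (klEngQ8 P R).CR cc :=
  (min_le_right _ _).trans (min_le_left _ _)

/-- Entry 3: `klEngU₀10 ≤ klE5u P R (klEngQ7 P R) (klEngQ8 P R).CR cc` (class #6). -/
theorem klEngU₀10_le_klE5u : klEngU₀10 P R cc ≤ klE5u P R (klEngQ7 P R) (klEngQ8 P R).CR cc :=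
  (min_le_right _ _).trans ((min_le_right _ _).trans (min_le_left _ _))

/-- Entry 4: `klEngU₀10 ≤ klE5ShareU P R (klEngQ8 P R).CR cc` (class #3). -/
theorem klEngU₀10_le_klE5ShareU : klEngU₀10 P R cc ≤ klE5ShareU P R (klEngQ8 P R).CR cc :=
  (min_le_right _ _).trans ((min_le_right _ _).trans ((min_le_right _ _).trans (min_le_left _ _)))

/-- Entry 5: `klEngU₀10 ≤ klE4UF klEngGeo8 P R (klEngQ8 P R) cc` (class #4). -/
theorem klEngU₀10_le_klE4UF : klEngU₀10 P R cc ≤ klE4UF klEngGeo8 P R (klEngQ8 P R) cc :=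
  (min_le_right _ _).trans ((min_le_right _ _).trans ((min_le_right _ _).trans ((min_le_right _ _).trans (min_le_left _ _))))

/-- Entry 6: `klEngU₀10 ≤ klCTu P R (klEngQ7 P R) (klEngQ8 P R).CR cc` (class #5). -/
theorem klEngU₀10_le_klCTu : klEngU₀10 P R cc ≤ klCTu P R (klEngQ7 P R) (klEngQ8 P R).CR cc :=
  (min_le_right _ _).trans ((min_le_right _ _).trans ((min_le_right _ _).trans ((min_le_right _ _).trans
    ((min_le_right _ _).trans (min_le_left _ _)))))

/-- Entry 7: `klEngU₀10 ≤ klE5RowsU P R` ((c)-E5 line (b)). -/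
theorem klEngU₀10_le_klE5RowsU : klEngU₀10 P R cc ≤ klE5RowsU P R :=
  (min_le_right _ _).trans ((min_le_right _ _).trans ((min_le_right _ _).trans ((min_le_right _ _).trans
    ((min_le_right _ _).trans ((min_le_right _ _).trans (min_le_left _ _))))))

/-- Entry 8: `klEngU₀10 ≤ klE5RateU R` ((c)-E5 line (c)). -/
theorem klEngU₀10_le_klE5RateU : klEngU₀10 P R cc ≤ klE5RateU R :=
  (min_le_right _ _).trans ((min_le_right _ _).trans ((min_le_right _ _).trans ((min_le_right _ _).trans
    ((min_le_right _ _).trans ((min_le_right _ _).trans (min_le_right _ _))))))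

variable {R}

/-- `0 < klEngU₀10 P R cc` whenever `0 < R.cz` (every other entry is positive unconditionally). -/
theorem klEngU₀10_pos (h : 0 < R.cz) : 0 < klEngU₀10 P R cc :=
  lt_min (klEngU₀9_pos P h cc)
    (lt_min (klCUu_pos P R _ _ cc)
      (lt_min (klE5u_pos P R _ _ cc)
        (lt_min (klE5ShareU_pos P R _ cc)
          (lt_min (klE4UF_pos _ P R _ cc) (lt_min (klCTu_pos P R _ _ cc) (lt_min (klE5RowsU_pos P R) (klE5RateU_pos R)))))))

/-- `0 < klEngU₀10 P R cc` under `R.WF2`. -/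
theorem klEngU₀10_pos_of_WF2 (hR : R.WF2) : 0 < klEngU₀10 P R cc := klEngU₀10_pos P cc hR.2.2

variable (R)

/-- `klEngU₀10 ≤ klEngU₀8`. -/
theorem klEngU₀10_le_klEngU₀8 : klEngU₀10 P R cc ≤ klEngU₀8 P R cc := (klEngU₀10_le_klEngU₀9 P R cc).trans (klEngU₀9_le_klEngU₀8 P R cc)

/-- `klEngU₀10 ≤ klEngU₀6` (the (E1-W)₀ / (E4)₀ / two-leg doors of the scale-`0` closers ride). -/
theorem klEngU₀10_le_klEngU₀6 : klEngU₀10 P R cc ≤ klEngU₀6 P R cc := (klEngU₀10_le_klEngU₀9 P R cc).trans (klEngU₀9_le_klEngU₀6 P R cc)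

/-- `klEngU₀10 ≤ klEngU₀4`. -/
theorem klEngU₀10_le_klEngU₀4 : klEngU₀10 P R cc ≤ klEngU₀4 P R cc := (klEngU₀10_le_klEngU₀9 P R cc).trans (klEngU₀9_le_klEngU₀4 P R cc)

/-- `klEngU₀10 ≤ klEngU₀3`. -/
theorem klEngU₀10_le_klEngU₀3 : klEngU₀10 P R cc ≤ klEngU₀3 P R cc := (klEngU₀10_le_klEngU₀9 P R cc).trans (klEngU₀9_le_klEngU₀3 P R cc)

/-- `klEngU₀10 ≤ klE3U₀all` (the all-scales allowance door of …DefsU7 §4). -/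
theorem klEngU₀10_le_klE3U₀all : klEngU₀10 P R cc ≤ klE3U₀all R := (klEngU₀10_le_klEngU₀9 P R cc).trans (klEngU₀9_le_klE3U₀all P R cc)

/-- `klEngU₀10 ≤ R.cz · klEngU₀4` (the polynomial-killer cap of token #10 rides). -/
theorem klEngU₀10_le_cz_mul_klEngU₀4 : klEngU₀10 P R cc ≤ R.cz * klEngU₀4 P R cc :=
  (klEngU₀10_le_klEngU₀9 P R cc).trans (klEngU₀9_le_cz_mul_klEngU₀4 P R cc)

variable {R}

/-- `klEngU₀10 ≤ klEngU₀7` (`0 < R.cz`). -/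
theorem klEngU₀10_le_klEngU₀7 (h : 0 < R.cz) : klEngU₀10 P R cc ≤ klEngU₀7 P R cc :=
  (klEngU₀10_le_klEngU₀9 P R cc).trans (klEngU₀9_le_klEngU₀7 P h cc)

/-- `klEngU₀10 ≤ klE3U₀` (`0 < R.cz`; so the scale-`0` numerals of …DefsU7 §3 apply). -/
theorem klEngU₀10_le_klE3U₀ (h : 0 < R.cz) : klEngU₀10 P R cc ≤ klE3U₀ R := (klEngU₀10_le_klEngU₀9 P R cc).trans (klEngU₀9_le_klE3U₀ P h cc)

end Projections

/-! ## §3 The riders of the v1 door and the two (c)-E5 lines, below `klEngU₀10` -/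

/-- **The budget hook of token #10 below the v2 door**: `0 ≤ K`, `0 < U ≤ klEngU₀10 P R c` ⟹ `K·U² ≤ R.cz·|U|·(K·klEngU₀4 P R c)`. -/
theorem sq_budget_of_le_klEngU₀10 {P : SplitConsts} {R : RenConsts} {c U K : ℝ} (hK : 0 ≤ K) (hU : 0 < U) (hUle : U ≤ klEngU₀10 P R c) :
    K * U ^ 2 ≤ R.cz * |U| * (K * klEngU₀4 P R c) :=
  sq_budget_of_le_klEngU₀9 hK hU (hUle.trans (klEngU₀10_le_klEngU₀9 P R c))

/-- **The four scale-`0` numerals of the bare-frame two-leg closers below the v2 door** (`0 < R.cz`, `0 < U ≤ klEngU₀10 P R c`). -/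
theorem bareFrame_numerals_of_le_klEngU₀10 (P : SplitConsts) {R : RenConsts} (hcz : 0 < R.cz) {c U : ℝ} (hU : 0 < U)
    (hU10 : U ≤ klEngU₀10 P R c) :
    16 * Real.exp 1 ^ 9 * Real.sqrt (2 * (7 + 1606732)) ^ 2 * klScaleZeroA0 * |U| ≤ 1 / 4 ∧
    16 * Real.exp 1 ^ 9 * Real.sqrt (2 * (7 + 1606732)) ^ 2 * klE3A1 R * |U| ≤ 1 / 2 ∧
    (2 : ℝ) ^ 10 * Real.exp 1 ^ 18 * Real.sqrt (2 * (7 + 1606732)) ^ 4 * klE3A1 R * U ^ 2 ≤ R.cz * |U| ∧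
    (2 : ℝ) ^ 11 * Real.exp 1 ^ 18 * Real.sqrt (2 * (7 + 1606732)) ^ 4 * klE3A1 R * U ^ 2 + 4 / 3 * R.Gfr 1 * U ^ 2 ≤
      R.cz * |U| * (cDtmin (-1.2) (-0.05) / 2) :=
  bareFrame_numerals_of_le_klEngU₀9 P hcz hU (hU10.trans (klEngU₀10_le_klEngU₀9 P R c))

/-- **(c)-E5 line (b) below the v2 door**: `0 < U ≤ klEngU₀10 P R c ⟹ U · klE5RowsD klEngGeo8 P (klEngQ8 P R) ≤ 1/4`. -/
theorem mul_klE5RowsD_le_quarter_of_le_klEngU₀10 {P : SplitConsts} {R : RenConsts} {c U : ℝ} (hU : 0 < U) (hU10 : U ≤ klEngU₀10 P R c) :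
    U * klE5RowsD klEngGeo8 P (klEngQ8 P R) ≤ 1 / 4 :=
  mul_klE5RowsD_le_quarter_of_le_klE5RowsU hU.le (hU10.trans (klEngU₀10_le_klE5RowsU P R c))

/-- The same in the displayed shape of `rowsSmallness_of_doors`'s `hD` at `(klEngGeo8, P, klEngQ8 P R)`. -/
theorem rowsSmallness_hD_of_le_klEngU₀10 {P : SplitConsts} {R : RenConsts} {c U : ℝ} (hU : 0 < U) (hU10 : U ≤ klEngU₀10 P R c) :
    U * ((∑ χ, (klEngGeo8.abot χ + klEngGeo8.atop χ) + 1) + 24 * (klEngQ8 P R).CR * (P.Klam ^ 2 + P.Klam ^ 3) +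
        16 / 3 * klEngGeo8.CF * P.Klam ^ 2 + klEngGeo8.cloc * P.Klam ^ 2 * (1 - (4 : ℝ) ^ (-klEngGeo8.θ))⁻¹ +
          2 * (klEngQ8 P R).CR * P.Klam ^ 3 + 4 / 3 * (klEngQ8 P R).CR * P.Klam ^ 2) ≤ 1 / 4 :=
  mul_klE5RowsD_le_quarter_of_le_klEngU₀10 hU hU10

/-- **(c)-E5 line (c) below the v2 door**: `0 < U ≤ klEngU₀10 P R c ⟹ R.Gfr 0 · |U| ≤ klE0/32`. -/
theorem gfr0_mul_abs_le_of_le_klEngU₀10 {P : SplitConsts} {R : RenConsts} {c U : ℝ} (hU : 0 < U) (hU10 : U ≤ klEngU₀10 P R c) :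
    R.Gfr 0 * |U| ≤ klE0 / 32 :=
  gfr0_mul_abs_le_of_le_klE5RateU hU.le (hU10.trans (klEngU₀10_le_klE5RateU P R c))

/-- `(klEngQ8 P R).CL = (klEngQ7 P R).CL` restated for the (c)-E5 volume line: with token #16, `sum_CL_klEngQ7_div_le P R hβ hU hn
(klEngL4Real_le_of_klEngL₄_le hL)` (…EngineIsoTupleSmallness + …DefsL4) IS `Σ_{j<n} (klEngQ8 P R).CL β j / L ≤ U/4` — no import of either here. -/
theorem klEngQ8_CL_apply (P : SplitConsts) (R : RenConsts) (β : ℝ) (n : ℕ) : (klEngQ8 P R).CL β n = (klEngQ7 P R).CL β n := rfl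

end Summit.HubbardSuperconductivity.HubbardSuperconductivity.Theorems.EngineV8

end
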